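import Summits.AnomalousDissipation.AnomalousDissipation.Theorems.MomentParityQuarticGateCoords
import Literature.Analysis.FluidPDE.CylindricalGenerator

/-!
# `MomentParity.MomentClosure` (stmt-AnomalousDissipation-11467), helper I: the compact carrier
# and the enstrophy functionals on level-`N` fields

Support file for the proof of
`Summit.AnomalousDissipation.AnomalousDissipation.Theses.MomentParity.MomentClosure`
(weak-* compactness in the moment order `d` at fixed `(f, ν, N, E, ε, R, κ)`).

* `norm_mFourierCoeff_coe_le`, `norm_mFourierCoeff_coe_sub_le`, `continuous_mFourierCoeff_coe` —
  a single Fourier coefficient `u ↦ û(k)` is `1`-Lipschitz on `H = L²_σ(T³)` (Bessel);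
* `eGradNormSq_fourierTruncate_coe`, `eGradNormSq_coe_of_isLevel`, `continuous_bandEnstrophy` —
  on level-`N` fields the spectral enstrophy `‖∇u‖₂²` and all truncated enstrophies `‖∇P_M u‖₂²`
  are the CONTINUOUS finite sums `4π² Σ_{k ∈ ball} |k|² ‖û(k)‖²` on `H`;
* `isCompact_levelBall` — the carrier `{u ∈ H : u level-N, ‖u‖ ≤ R}` of the measures of the item is
  COMPACT: it is the image of the coefficient ball `Σ xᵢ² ≤ R²` under the synthesis map of the
  orthonormal band basis of `MomentParityQuarticGateBasis` / `…Coords`.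

Vocabulary (`T3`, `R3`, `H3`, `IsLevel`, `IsBandTest`, `polyGrad`) from
`CubicParityLoud.Negative.Clauses`; all of it unfolds definitionally to the clauses of the item.
-/

noncomputable section

-- `Summit.<Summit>.<Problem>` is the tree's mandated summit-side namespace (CONVENTIONS §2); for this
-- single-conjunct summit the two coincide, so the duplicate is deliberate.
set_option linter.dupNamespace false

namespace Summit.AnomalousDissipation.AnomalousDissipation.Theorems.MomentParityMomentClosure

open MeasureTheory Filter Topology UnitAddTorus
open scoped InnerProductSpace RealInnerProductSpace ENNReal NNReal
open Literature.Analysis.FunctionSpaces Literature.Analysis.FluidPDE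
open Summit.AnomalousDissipation.AnomalousDissipation.Theorems.CubicParityLoud.Negative
open Summit.AnomalousDissipation.AnomalousDissipation.Theorems.MomentParityQuarticGate

/-! ## Fourier coefficients are `1`-Lipschitz on `H` -/

/-- **Bessel on `H`**: `‖û(k)‖ ≤ ‖u‖` for `u ∈ H` and every frequency `k`. [folklore] -/
theorem norm_mFourierCoeff_coe_le (u : H3) (k : Fin 3 → ℤ) :
    ‖mFourierCoeff (EuclideanSpace.complexify ∘ (u.1 : T3 → R3)) k‖ ≤ ‖u‖ := by
  have hmem : MemLp (u.1 : T3 → R3) 2 volume := Lp.memLp u.1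
  have hpar := Torus.hasSum_sq_norm_mFourierCoeff_complexify hmem
  have h1 : ‖mFourierCoeff (EuclideanSpace.complexify ∘ (u.1 : T3 → R3)) k‖ ^ 2 ≤ ‖u‖ ^ 2 := by
    calc ‖mFourierCoeff (EuclideanSpace.complexify ∘ (u.1 : T3 → R3)) k‖ ^ 2
        ≤ ∫ x, ‖(u.1 : T3 → R3) x‖ ^ 2 := le_hasSum hpar k fun j _ => sq_nonneg _
      _ = ‖u‖ ^ 2 := by rw [Torus.integral_norm_sq_coe_eq]; rfl
  exact (pow_le_pow_iff_left₀ (norm_nonneg _) (norm_nonneg _) two_ne_zero).1 h1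

/-- The Fourier coefficient map `u ↦ û(k)` is `1`-Lipschitz on `H`:
`‖û(k) - v̂(k)‖ ≤ ‖u - v‖`. [folklore] -/
theorem norm_mFourierCoeff_coe_sub_le (u v : H3) (k : Fin 3 → ℤ) :
    ‖mFourierCoeff (EuclideanSpace.complexify ∘ (u.1 : T3 → R3)) k -
        mFourierCoeff (EuclideanSpace.complexify ∘ (v.1 : T3 → R3)) k‖ ≤ ‖u - v‖ := by
  have hu : Integrable (u.1 : T3 → R3) volume := (Lp.memLp u.1).integrable one_le_two
  have hv : Integrable (v.1 : T3 → R3) volume := (Lp.memLp v.1).integrable one_le_two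
  have hsub : mFourierCoeff (EuclideanSpace.complexify ∘ (u.1 : T3 → R3)) k -
      mFourierCoeff (EuclideanSpace.complexify ∘ (v.1 : T3 → R3)) k =
        mFourierCoeff (EuclideanSpace.complexify ∘ ((u - v).1 : T3 → R3)) k := by
    rw [← Torus.mFourierCoeff_sub (Torus.integrable_complexify_comp hu)
      (Torus.integrable_complexify_comp hv), ← Torus.complexify_comp_sub]
    refine Torus.mFourierCoeff_congr_ae ?_ k
    rw [Submodule.coe_sub]
    filter_upwards [Lp.coeFn_sub u.1 v.1] with x hx
    simp only [Function.comp_apply, hx]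
  rw [hsub]
  exact norm_mFourierCoeff_coe_le (u - v) k

/-- The Fourier coefficient `u ↦ û(k)` is continuous on `H`. [folklore] -/
theorem continuous_mFourierCoeff_coe (k : Fin 3 → ℤ) :
    Continuous fun u : H3 => mFourierCoeff (EuclideanSpace.complexify ∘ (u.1 : T3 → R3)) k :=
  (LipschitzWith.of_dist_le_mul (K := 1) fun u v => by
    rw [dist_eq_norm, dist_eq_norm, NNReal.coe_one, one_mul]
    exact norm_mFourierCoeff_coe_sub_le u v k).continuous

/-! ## Enstrophy functionals on level-`N` fields -/

/-- **Truncated enstrophy, spectrally**: `‖∇P_M u‖₂² = 4π² Σ_{|k| ≤ M} |k|² ‖û(k)‖²` for every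
`u ∈ H` (as an extended real). [folklore] -/
theorem eGradNormSq_fourierTruncate_coe (M : ℕ) (u : H3) :
    Torus.eGradNormSq (Torus.fourierTruncate M (u.1 : T3 → R3)) =
      ENNReal.ofReal (4 * Real.pi ^ 2 * ∑ k ∈ Torus.freqBall M,
        Torus.freqNormSq k * ‖mFourierCoeff (EuclideanSpace.complexify ∘ (u.1 : T3 → R3)) k‖ ^ 2) := by
  have hint : Integrable (u.1 : T3 → R3) volume := (Lp.memLp u.1).integrable one_le_two
  rw [Torus.fourierTruncate_eq,
    Torus.eGradNormSq_realTrigPoly Torus.neg_mem_freqBall_of_mem (Torus.isConjSymm_mFourierCoeff hint)]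

/-- **Enstrophy of a level-`N` field, spectrally**: `‖∇u‖₂² = 4π² Σ_{|k| ≤ N} |k|² ‖û(k)‖²`. [folklore] -/
theorem eGradNormSq_coe_of_isLevel {N : ℕ} {u : H3} (hu : IsLevel N u) :
    Torus.eGradNormSq (u.1 : T3 → R3) =
      ENNReal.ofReal (4 * Real.pi ^ 2 * ∑ k ∈ Torus.freqBall N,
        Torus.freqNormSq k * ‖mFourierCoeff (EuclideanSpace.complexify ∘ (u.1 : T3 → R3)) k‖ ^ 2) := by
  rw [← eGradNormSq_fourierTruncate_of_isLevel hu, eGradNormSq_fourierTruncate_coe]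

/-- The band enstrophy `u ↦ 4π² Σ_{k ∈ S} |k|² ‖û(k)‖²` is nonnegative. [folklore] -/
theorem bandEnstrophy_nonneg (S : Finset (Fin 3 → ℤ)) (u : H3) :
    0 ≤ 4 * Real.pi ^ 2 * ∑ k ∈ S,
      Torus.freqNormSq k * ‖mFourierCoeff (EuclideanSpace.complexify ∘ (u.1 : T3 → R3)) k‖ ^ 2 :=
  mul_nonneg (by positivity) (Finset.sum_nonneg fun k _ =>
    mul_nonneg (Torus.freqNormSq_nonneg k) (sq_nonneg _))

/-- The band enstrophy `u ↦ 4π² Σ_{k ∈ S} |k|² ‖û(k)‖²` is continuous on `H`. [folklore] -/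
theorem continuous_bandEnstrophy (S : Finset (Fin 3 → ℤ)) :
    Continuous fun u : H3 => 4 * Real.pi ^ 2 * ∑ k ∈ S,
      Torus.freqNormSq k * ‖mFourierCoeff (EuclideanSpace.complexify ∘ (u.1 : T3 → R3)) k‖ ^ 2 :=
  continuous_const.mul (continuous_finsetSum S fun k _ =>
    continuous_const.mul ((continuous_mFourierCoeff_coe k).norm.pow 2))

/-! ## The compact carrier -/

/-- **The level-`N` ball is compact**: `{u ∈ H : û(k) = 0 off 0 < |k|² ≤ N², ‖u‖ ≤ R}` is a compact
subset of `H` (`0 ≤ R`). It is the image of the compact coefficient ball `{x ∈ ℝⁿ : Σ xᵢ² ≤ R²}` under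
the continuous synthesis map `x ↦ Σ xᵢ Bᵢ` of an orthonormal band basis (`exists_bandBasis`,
`exists_synthesis`): a level-`N` field is `Σᵢ (u, bᵢ) bᵢ` with `‖u‖² = Σᵢ (u, bᵢ)²`. [folklore] -/
theorem isCompact_levelBall (N : ℕ) {R : ℝ} (hR : 0 ≤ R) :
    IsCompact {u : H3 | IsLevel N u ∧ ‖u‖ ≤ R} := by
  obtain ⟨n, b, hb, hbo, hbs⟩ := exists_bandBasis N
  obtain ⟨B, hB⟩ := exists_synthesis hb hbo
  set D : Set (Fin n → ℝ) := {x | ∑ i, x i ^ 2 ≤ R ^ 2} with hD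
  have hDc : IsCompact D := by
    refine Metric.isCompact_of_isClosed_isBounded ?_ ?_
    · exact isClosed_le (continuous_finsetSum _ fun i _ => (continuous_apply i).pow 2)
        continuous_const
    · refine (Metric.isBounded_closedBall (x := (0 : Fin n → ℝ)) (r := R)).subset fun x hx => ?_
      rw [mem_closedBall_zero_iff, pi_norm_le_iff_of_nonneg hR]
      intro i
      have hx' : ∑ j, x j ^ 2 ≤ R ^ 2 := hx
      have hi : x i ^ 2 ≤ R ^ 2 :=
        (Finset.single_le_sum (fun j _ => sq_nonneg (x j)) (Finset.mem_univ i)).trans hx'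
      rw [Real.norm_eq_abs]
      exact abs_le_of_sq_le_sq hi hR
  have hS : Continuous fun x : Fin n → ℝ => (∑ i, x i • B i : H3) :=
    continuous_finsetSum _ fun i _ => (continuous_apply i).smul continuous_const
  have heq : {u : H3 | IsLevel N u ∧ ‖u‖ ≤ R} = (fun x : Fin n → ℝ => (∑ i, x i • B i : H3)) '' D := by
    ext u
    constructor
    · rintro ⟨hu, huR⟩
      refine ⟨fun i => Torus.pairing u.1 (b i), ?_, ?_⟩
      · show ∑ i, (Torus.pairing u.1 (b i)) ^ 2 ≤ R ^ 2
        rw [← norm_sq_eq_sum_sq_coords hb hbo hbs u hu]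
        exact pow_le_pow_left₀ (norm_nonneg _) huR 2
      · obtain ⟨-, -, -, h4⟩ := hB (fun i => Torus.pairing u.1 (b i))
        have h5 := coe_ae_eq_sum_of_level hbs u hu
        exact Subtype.ext (Lp.ext (h4.trans h5.symm))
    · rintro ⟨x, hx, rfl⟩
      obtain ⟨h1, -, h3, -⟩ := hB x
      refine ⟨h1, ?_⟩
      have hx' : ∑ j, x j ^ 2 ≤ R ^ 2 := hx
      have h6 : ‖(∑ i, x i • B i : H3)‖ ^ 2 ≤ R ^ 2 := h3 ▸ hx'
      exact (pow_le_pow_iff_left₀ (norm_nonneg _) hR two_ne_zero).1 h6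
  rw [heq]
  exact hDc.image hS

end Summit.AnomalousDissipation.AnomalousDissipation.Theorems.MomentParityMomentClosure

end
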